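import Summits.FinalStateConjecture.FinalStateConjecture.Theorems.SwallowTheDatumParametricKerrBurialStubTransportPatchB

/-!
# `ParametricKerrBurial`, line `receding-annulus-universal-collar` — stub `stub_endChartDatum` (A2a1)
# (crux item stmt-FinalStateConjecture-10052)

The registered stub `stub_endChartDatum`, proved. For an admissible datum `d ∈ 𝓓(X)` take the sole
Dafermos–Rodnianski end `(e, M)` given by admissibility (`mem_admissibleVacuumData_iff`) and
package the chart data of the end — the coefficient fields `AFEnd.hCoeff e d`, `AFEnd.kCoeff e d`
on `{e.R < ‖y‖} ⊆ ℝ³` — as ONE initial data set `I₀` on `E3 = ℝ³`: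

  `h₀ = χ δ + (1 − χ) hCoeff e d`,  `k₀ = (1 − χ) kCoeff e d`,  `χ(y) = S(4 − ‖y‖²/e.R²)`

(`S = Real.smoothTransition`; `χ = 1` on `{‖y‖² ≤ 3 e.R²}`, `χ = 0` on `{2 e.R ≤ ‖y‖}`,
`0 ≤ χ ≤ 1`). The fields are smooth on all of `E3` (near the closed ball `‖y‖ ≤ e.R`, where the
chart components are junk, the factor `1 − χ` vanishes identically), `h₀` is positive definite
(convex combination of `δ` and the positive definite `hCoeff`), and on `{2 e.R ≤ ‖y‖}` the datum
IS the chart reading of `d`. Hence `I₀` solves the vacuum constraints on the open set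
`{2 e.R < ‖y‖}`: there its restriction is the pullback of `d` along the inverse chart
`dataChartExt` (`InitialDataSet.ext'`), and the constraint map is natural pointwise under local
diffeomorphisms (`InitialDataSet.isVacuumAt_comap_iff`, Bartnik–Isenberg 2004, §2).

* `exists_initialDataSet_of_contDiff` — an initial data set on `ℝ³` with prescribed smooth
  coefficient fields (bundle smoothness over the model space is plain smoothness,
  `contMDiffAt_bilinE3_iff`);
* `vacuumOn_of_chartReading` — a datum on `ℝ³` reading vacuum data through the chart of an end on
  an open set is vacuum there;
* `exists_endChartDatum` — the cut-off construction; `stub_endChartDatum` — the registered stub.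

References: Corvino 2000, §4 (cut-off patching beyond a coordinate sphere); Bartnik 1986, §1,
(1.3) (the chart components); Bartnik–Isenberg 2004, §2 (locality and diffeomorphism equivariance
of the constraint map); Dafermos–Rodnianski 2013, App. B.2.3 (the end of admissible data).
-/

-- the doubled `FinalStateConjecture` path component is the summit/problem naming scheme, not a mistake
set_option linter.dupNamespace false
-- instance problems on the nested operator type `E3 →L[ℝ] E3 →L[ℝ] ℝ` (e.g. `IsBoundedSMul ℝ _`, used by
-- `ContDiff.smul`) need one more level of pending instance synthesis than the default
set_option maxSynthPendingDepth 2

noncomputable section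

namespace Summit.FinalStateConjecture.FinalStateConjecture.Theorems.SwallowTheDatum.ParametricKerrBurial

open scoped Manifold ContDiff Topology InnerProductSpace RealInnerProductSpace
-- NB: no `open Bundle` (instance synthesis time-outs downstream); `Bundle.TotalSpace.mk'` is qualified.
open Set Filter Function Metric Literature.Geometry.Lorentzian Literature.Geometry.Manifold

/-! ## §1 Initial data sets on `ℝ³` from smooth coefficient fields -/

section OnE3

/-- A `C^∞` map `E3 → (E3 →L E3 →L ℝ)` is a `C^∞` section of the bundle of bilinear forms on `TE3`
(the tangent bundle of the model space is trivialised by the identity, `contMDiffAt_bilinE3_iff`).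
[folklore] -/
theorem contMDiff_bilinSection_of_contDiff {s : E3 → E3 →L[ℝ] E3 →L[ℝ] ℝ} (hs : ContDiff ℝ ∞ s) :
    ContMDiff (𝓡 3) ((𝓡 3).prod 𝓘(ℝ, E3 →L[ℝ] E3 →L[ℝ] ℝ)) ∞
      (fun y : E3 ↦ Bundle.TotalSpace.mk' (E3 →L[ℝ] E3 →L[ℝ] ℝ)
        (E := fun x : E3 ↦ TangentSpace (𝓡 3) x →L[ℝ] TangentSpace (𝓡 3) x →L[ℝ] ℝ) y (s y)) := fun _ ↦
  (contMDiffAt_bilinE3_iff (b := fun y : E3 ↦ y) (s := s)).2 ⟨contMDiffAt_id, hs.contDiffAt.contMDiffAt⟩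

/-- **An initial data set on `ℝ³` with prescribed smooth coefficient fields**: smooth fields
`g, κ : E3 → (E3 →L E3 →L ℝ)` of symmetric bilinear forms, `g` positive definite, are the
coordinate readings `coordH`, `coordK` of an initial data set on `E3` (`T_y E3 = E3`).
Bartnik–Isenberg 2004, §2 (initial data sets in coordinates). [cite: BartnikIsenberg2004, §2] -/
theorem exists_initialDataSet_of_contDiff (g κ : E3 → E3 →L[ℝ] E3 →L[ℝ] ℝ) (hg : ContDiff ℝ ∞ g)
    (hκ : ContDiff ℝ ∞ κ) (hgs : ∀ y v w, g y v w = g y w v) (hgp : ∀ y v, v ≠ 0 → 0 < g y v v)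
    (hκs : ∀ y v w, κ y v w = κ y w v) :
    ∃ I₀ : InitialDataSet (𝓡 3) E3, I₀.coordH = g ∧ I₀.coordK = κ :=
  ⟨{ h :=
      { inner := fun y ↦ g y
        symm := fun y v w ↦ hgs y v w
        pos := fun y v hv ↦ hgp y v hv
        isVonNBounded := fun y ↦
          PseudoRiemannianMetric.IsSpacelikeImmersion.isVonNBounded_setOf_lt_one_of_pos (V := E3) (g y)
            (hgp y)
        contMDiff := contMDiff_bilinSection_of_contDiff hg }
     k := fun y ↦ κ y
     k_symm := fun y v w ↦ hκs y v w
     contMDiff_k := contMDiff_bilinSection_of_contDiff hκ }, rfl, rfl⟩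

/-- **Cutting off a field which is smooth outside a ball**: if `χ : E3 → ℝ` is smooth and `χ = 1`
near every point of the closed ball `‖y‖ ≤ ρ`, and `F` is smooth on `{ρ < ‖y‖}`, then
`(1 − χ) F` is smooth on all of `E3` (near the ball it vanishes identically). Corvino 2000, §4
(cut-off functions in gluing constructions). [cite: Corvino2000, §4] -/
theorem contDiff_one_sub_smul {ρ : ℝ} {χ : E3 → ℝ} (hχs : ContDiff ℝ ∞ χ)
    (hχ1 : ∀ y : E3, ‖y‖ ≤ ρ → ∀ᶠ z in 𝓝 y, χ z = 1) {F : E3 → E3 →L[ℝ] E3 →L[ℝ] ℝ}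
    (hF : ContDiffOn ℝ ∞ F {x | ρ < ‖x‖}) : ContDiff ℝ ∞ fun y ↦ (1 - χ y) • F y := by
  refine contDiff_iff_contDiffAt.2 fun y ↦ ?_
  by_cases hy : ρ < ‖y‖
  · exact (contDiffAt_const.sub hχs.contDiffAt).smul
      (hF.contDiffAt ((isOpen_lt continuous_const continuous_norm).mem_nhds hy))
  · refine (contDiffAt_const (c := (0 : E3 →L[ℝ] E3 →L[ℝ] ℝ))).congr_of_eventuallyEq ?_
    filter_upwards [hχ1 y (not_lt.1 hy)] with z hz
    rw [hz, sub_self]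
    exact zero_smul ℝ (F z)

/-- The cut-off `χ(y) = S(4 − ‖y‖²/ρ²)` is smooth on `E3`. [folklore] -/
theorem contDiff_cutoff (ρ : ℝ) :
    ContDiff ℝ ∞ fun y : E3 ↦ Real.smoothTransition (4 - ‖y‖ ^ 2 / ρ ^ 2) :=
  Real.smoothTransition.contDiff.comp (contDiff_const.sub ((contDiff_norm_sq ℝ).div_const _))

/-- The cut-off vanishes beyond radius `2ρ`. [folklore] -/
theorem cutoff_eq_zero {ρ : ℝ} (hρ : 0 < ρ) {y : E3} (hy : 2 * ρ ≤ ‖y‖) :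
    Real.smoothTransition (4 - ‖y‖ ^ 2 / ρ ^ 2) = 0 := by
  apply Real.smoothTransition.zero_of_nonpos
  rw [sub_nonpos, le_div_iff₀ (pow_pos hρ 2)]
  nlinarith [norm_nonneg y]

/-- The cut-off is `1` inside radius `3ρ/2`. [folklore] -/
theorem cutoff_eq_one {ρ : ℝ} (hρ : 0 < ρ) {y : E3} (hy : ‖y‖ < 3 / 2 * ρ) :
    Real.smoothTransition (4 - ‖y‖ ^ 2 / ρ ^ 2) = 1 := by
  apply Real.smoothTransition.one_of_one_le
  rw [le_sub_comm, div_le_iff₀ (pow_pos hρ 2)]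
  have h1 : ‖y‖ ^ 2 ≤ (3 / 2 * ρ) ^ 2 := pow_le_pow_left₀ (norm_nonneg y) hy.le 2
  nlinarith

end OnE3

/-! ## §2 Reading the end of a datum through its chart -/

section Chart

variable {X : Type} [TopologicalSpace X] [ChartedSpace E3 X] [IsManifold (𝓡 3) ∞ X]

/-- **The chart components of the metric are positive definite** (everywhere: beyond radius `e.R`
they evaluate `h` on chart directions, `dΦ` injective; inside, the junk value is `δ`).
Bartnik 1986, §1, (1.3). [cite: Bartnik1986, §1, (1.3)] -/
theorem hCoeff_pos (e : AFEnd X) (d : InitialDataSet (𝓡 3) X) (y : E3) {v : E3} (hv : v ≠ 0) :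
    0 < AFEnd.hCoeff e d y v v := by
  by_cases hy : e.R < ‖y‖
  · rw [e.hCoeff_apply_eq_dataChartExt d hy v v]
    exact d.h.pos _ _ fun h0 ↦
      hv ((injective_iff_map_eq_zero _).1 (e.injective_mfderiv_dataChartExt hy) v h0)
  · unfold AFEnd.hCoeff
    rw [dif_neg hy]
    exact real_inner_self_pos.2 hv

/-- **A datum on `ℝ³` which reads vacuum data through the chart of an end is vacuum there.** If
`I₀` has the coordinate readings `coordH = hCoeff e d`, `coordK = kCoeff e d` on an open set
`V ⊆ {e.R < ‖y‖}` and `d` solves the vacuum constraints, then so does `I₀` on `V`: the restriction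
of `I₀` to `V` IS the pullback of `d` along `dataChartExt ∘ (V ↪ E3)` (a local diffeomorphism),
and the constraint map is natural pointwise. Bartnik–Isenberg 2004, §2.
[cite: BartnikIsenberg2004, §2] -/
theorem vacuumOn_of_chartReading (e : AFEnd X) (d : InitialDataSet (𝓡 3) X)
    (hd : ∀ [d.metric.HasLeviCivita], d.IsVacuumConstraintSolution) (I₀ : InitialDataSet (𝓡 3) E3)
    (V : TopologicalSpace.Opens E3) (hVR : ∀ y ∈ V, e.R < ‖y‖)
    (hH : ∀ y ∈ V, I₀.coordH y = AFEnd.hCoeff e d y)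
    (hK : ∀ y ∈ V, I₀.coordK y = AFEnd.kCoeff e d y) : VacuumOn (V : Set E3) I₀ := by
  intro inst y hy
  haveI : d.metric.HasLeviCivita := d.metric.hasLeviCivita
  -- the inverse chart on `V`, a local diffeomorphism into `X`
  have hΦ : ContMDiff (𝓡 3) (𝓡 3) (∞ + 1) (e.dataChartExt ∘ (Subtype.val : V → E3)) := fun u ↦
    (e.contMDiffAt_dataChartExt (hVR u u.2)).comp u contMDiff_subtype_val.contMDiffAt
  have hchain : ∀ (u : V) (v : TangentSpace (𝓡 3) u),
      mfderiv (𝓡 3) (𝓡 3) (e.dataChartExt ∘ (Subtype.val : V → E3)) u v =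
        mfderiv 𝓘(ℝ, E3) (𝓡 3) e.dataChartExt (u : E3)
          (mfderiv (𝓡 3) (𝓡 3) (Subtype.val : V → E3) u v) := by
    intro u v
    have hc : MDifferentiableAt 𝓘(ℝ, E3) (𝓡 3) e.dataChartExt ((Subtype.val : V → E3) u) :=
      (e.contMDiffAt_dataChartExt (hVR u u.2)).mdifferentiableAt (by simp)
    have hv : MDifferentiableAt (𝓡 3) 𝓘(ℝ, E3) (Subtype.val : V → E3) u :=
      (contMDiff_subtype_val (n := ∞)).mdifferentiableAt (by simp)
    rw [mfderiv_comp u hc hv]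
    rfl
  have hΦ' : ∀ u : V, Injective (mfderiv (𝓡 3) (𝓡 3) (e.dataChartExt ∘ (Subtype.val : V → E3)) u) := by
    intro u v w hvw
    rw [hchain, hchain] at hvw
    exact InitialDataSet.injective_mfderiv_subtypeVal V u
      (e.injective_mfderiv_dataChartExt (hVR u u.2) hvw)
  -- pointwise readings
  have hH' : ∀ y ∈ V, ∀ v w : E3, I₀.h.inner y v w = AFEnd.hCoeff e d y v w := fun y hy v w ↦ by
    rw [← hH y hy]; rfl
  have hK' : ∀ y ∈ V, ∀ v w : E3, I₀.k y v w = AFEnd.kCoeff e d y v w := fun y hy v w ↦ by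
    rw [← hK y hy]; rfl
  -- on `V`, the restriction of `I₀` IS the pullback of `d` along the inverse chart
  have heq : I₀.comap (Subtype.val : V → E3) (InitialDataSet.contMDiff_subtypeVal_succ V)
      (InitialDataSet.injective_mfderiv_subtypeVal V) =
        d.comap (e.dataChartExt ∘ (Subtype.val : V → E3)) hΦ hΦ' := by
    refine InitialDataSet.ext' (fun u v w ↦ ?_) (fun u v w ↦ ?_)
    · rw [InitialDataSet.comap_h_inner, InitialDataSet.comap_h_inner, hH' _ u.2, hchain, hchain,
        Function.comp_apply, e.hCoeff_apply_eq_dataChartExt d (hVR u u.2)]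
    · rw [InitialDataSet.comap_k, InitialDataSet.comap_k, hK' _ u.2, hchain, hchain,
        Function.comp_apply, e.kCoeff_apply_eq_dataChartExt d (hVR u u.2)]
  -- transport the vacuum constraints of `d` at the image point
  haveI h1 : (I₀.comap (Subtype.val : V → E3) (InitialDataSet.contMDiff_subtypeVal_succ V)
      (InitialDataSet.injective_mfderiv_subtypeVal V)).metric.HasLeviCivita :=
    PseudoRiemannianMetric.hasLeviCivita _
  haveI h2 : (d.comap (e.dataChartExt ∘ (Subtype.val : V → E3)) hΦ hΦ').metric.HasLeviCivita :=
    PseudoRiemannianMetric.hasLeviCivita _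
  have hdy : d.hamiltonianConstraintFn ((e.dataChartExt ∘ (Subtype.val : V → E3)) ⟨y, hy⟩) = 0 ∧
      d.momentumConstraintFn ((e.dataChartExt ∘ (Subtype.val : V → E3)) ⟨y, hy⟩) = 0 := hd _
  have hcomap := (InitialDataSet.isVacuumAt_comap_iff d hΦ hΦ' (⟨y, hy⟩ : V)).2 hdy
  have key : ∀ (A' B' : InitialDataSet (𝓡 3) V) [A'.metric.HasLeviCivita] [B'.metric.HasLeviCivita],
      A' = B' → (B'.hamiltonianConstraintFn ⟨y, hy⟩ = 0 ∧ B'.momentumConstraintFn ⟨y, hy⟩ = 0) →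
        (A'.hamiltonianConstraintFn ⟨y, hy⟩ = 0 ∧ A'.momentumConstraintFn ⟨y, hy⟩ = 0) := by
    rintro A' B' _ _ rfl hB
    exact hB
  exact (InitialDataSet.isVacuumAt_comap_iff I₀ (InitialDataSet.contMDiff_subtypeVal_succ V)
    (InitialDataSet.injective_mfderiv_subtypeVal V) (⟨y, hy⟩ : V)).1 (key _ _ heq hcomap)

/-- **Cut-off interpolation between a constant form and the chart data of an end.** For a
constant symmetric positive definite bilinear form `δ` on `E3` (the Euclidean one, say) and a smooth
cut-off `χ : E3 → [0, 1]` which is `1` near the closed ball `‖y‖ ≤ e.R`, the fields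
`χ δ + (1 − χ) hCoeff e d` and `(1 − χ) kCoeff e d` are the coordinate readings of an initial data
set on `ℝ³` (smooth: the chart components are smooth beyond radius `e.R`,
`AFEnd.ContDiffOn_hCoeff_holds`, and `1 − χ` vanishes near the ball; positive definite: a convex
combination of `δ` and the positive definite `hCoeff`). Corvino 2000, §4. [cite: Corvino2000, §4] -/
theorem exists_datum_of_cutoff (e : AFEnd X) (d : InitialDataSet (𝓡 3) X)
    (δ : E3 →L[ℝ] E3 →L[ℝ] ℝ) (hδs : ∀ v w, δ v w = δ w v) (hδp : ∀ v, v ≠ 0 → 0 < δ v v)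
    {χ : E3 → ℝ} (hχs : ContDiff ℝ ∞ χ) (hχ01 : ∀ y, 0 ≤ χ y ∧ χ y ≤ 1)
    (hχ1 : ∀ y : E3, ‖y‖ ≤ e.R → ∀ᶠ z in 𝓝 y, χ z = 1) :
    ∃ I₀ : InitialDataSet (𝓡 3) E3, ∀ y : E3,
      I₀.coordH y = χ y • δ + (1 - χ y) • AFEnd.hCoeff e d y ∧
        I₀.coordK y = (1 - χ y) • AFEnd.kCoeff e d y := by
  have hF : ContDiffOn ℝ ∞ (AFEnd.hCoeff e d) {x | e.R < ‖x‖} := AFEnd.ContDiffOn_hCoeff_holds e d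
  have hG : ContDiffOn ℝ ∞ (AFEnd.kCoeff e d) {x | e.R < ‖x‖} := AFEnd.ContDiffOn_kCoeff_holds e d
  obtain ⟨I₀, hH, hK⟩ := exists_initialDataSet_of_contDiff
    (fun y ↦ χ y • δ + (1 - χ y) • AFEnd.hCoeff e d y) (fun y ↦ (1 - χ y) • AFEnd.kCoeff e d y)
    ((hχs.smul contDiff_const).add (contDiff_one_sub_smul hχs hχ1 hF))
    (contDiff_one_sub_smul hχs hχ1 hG)
    (fun y v w ↦ by
      simp only [add_apply, smul_apply, smul_eq_mul, hδs v w, AFEnd.hCoeff_symm e d y v w])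
    (fun y v hv ↦ by
      obtain ⟨h0, h1⟩ := hχ01 y
      have hp : 0 < AFEnd.hCoeff e d y v v := hCoeff_pos e d y hv
      have hvv : 0 < δ v v := hδp v hv
      simp only [add_apply, smul_apply, smul_eq_mul]
      rcases h1.lt_or_eq with h1 | h1
      · exact add_pos_of_nonneg_of_pos (mul_nonneg h0 hvv.le) (mul_pos (sub_pos.2 h1) hp)
      · rw [h1, sub_self, zero_mul, add_zero, one_mul]
        exact hvv)
    (fun y v w ↦ by
      simp only [smul_apply, smul_eq_mul, AFEnd.kCoeff_symm e d y v w])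
  exact ⟨I₀, fun y ↦ ⟨congrFun hH y, congrFun hK y⟩⟩

/-- **The chart datum of the end.** For an end `e` of vacuum data `d` there is an initial data set
`I₀` on `ℝ³` whose coordinate readings ARE the chart data `hCoeff e d`, `kCoeff e d` on
`{2 e.R ≤ ‖y‖}` (the cut-off interpolation `exists_datum_of_cutoff` with `δ` the Euclidean form and
`χ(y) = S(4 − ‖y‖²/e.R²)`), hence vacuum on the open set `{2 e.R < ‖y‖}`
(`vacuumOn_of_chartReading`). Corvino 2000, §4; Bartnik–Isenberg 2004, §2. [cite: Corvino2000, §4] -/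
theorem exists_endChartDatum (e : AFEnd X) (d : InitialDataSet (𝓡 3) X)
    (hd : ∀ [d.metric.HasLeviCivita], d.IsVacuumConstraintSolution) :
    ∃ I₀ : InitialDataSet (𝓡 3) E3, VacuumOn {y | 2 * e.R < ‖y‖} I₀ ∧
      ∀ y : E3, 2 * e.R ≤ ‖y‖ → I₀.coordH y = AFEnd.hCoeff e d y ∧ I₀.coordK y = AFEnd.kCoeff e d y := by
  have hR := e.R_pos
  -- the cut-off `χ(y) = S(4 − ‖y‖²/e.R²)`: smooth, in `[0, 1]`, `= 1` near the ball, `= 0` beyond `2 e.R`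
  have hχ1 : ∀ y : E3, ‖y‖ ≤ e.R →
      ∀ᶠ z in 𝓝 y, Real.smoothTransition (4 - ‖z‖ ^ 2 / e.R ^ 2) = 1 := fun y hy ↦ by
    have hy' : ‖y‖ < 3 / 2 * e.R := by linarith
    filter_upwards [(isOpen_lt continuous_norm continuous_const).mem_nhds hy'] with z hz
    exact cutoff_eq_one hR hz
  obtain ⟨I₀, hI₀⟩ := exists_datum_of_cutoff e d (innerSL ℝ) (fun v w ↦ real_inner_comm w v)
    (fun v hv ↦ real_inner_self_pos.2 hv) (contDiff_cutoff e.R)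
    (fun y ↦ ⟨Real.smoothTransition.nonneg _, Real.smoothTransition.le_one _⟩) hχ1
  -- the chart reading beyond `2 e.R`
  have hread : ∀ y : E3, 2 * e.R ≤ ‖y‖ →
      I₀.coordH y = AFEnd.hCoeff e d y ∧ I₀.coordK y = AFEnd.kCoeff e d y := fun y hy ↦ by
    obtain ⟨hH, hK⟩ := hI₀ y
    rw [cutoff_eq_zero hR hy] at hH hK
    constructor
    · rw [hH]
      ext v w
      simp only [add_apply, smul_apply, smul_eq_mul, zero_mul, zero_add, sub_zero, one_mul]
    · rw [hK]
      ext v w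
      simp only [smul_apply, smul_eq_mul, sub_zero, one_mul]
  refine ⟨I₀, ?_, hread⟩
  -- vacuum on `{2 e.R < ‖y‖}`: there `I₀` reads `d` through the chart
  exact vacuumOn_of_chartReading e d hd I₀ ⟨{y | 2 * e.R < ‖y‖}, isOpen_lt continuous_const continuous_norm⟩
    (fun y hy ↦ by change 2 * e.R < ‖y‖ at hy; linarith)
    (fun y hy ↦ (hread y (le_of_lt hy)).1) (fun y hy ↦ (hread y (le_of_lt hy)).2)

end Chart

/-! ## §3 The stub -/

/-- **Stub `stub_endChartDatum`** (registered signature, line `receding-annulus-universal-collar`,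
crux item stmt-FinalStateConjecture-10052): for `d ∈ 𝓓(X)` take the sole Dafermos–Rodnianski end
`(e, M)` of admissibility and ONE datum `I₀` on `ℝ³` which is exactly the chart data of `d` on
`{2 e.R ≤ ‖y‖}`, hence vacuum on `{2 e.R < ‖y‖}` (`exists_endChartDatum`). Corvino 2000, §4;
Dafermos–Rodnianski 2013, App. B.2.3. [folklore] -/
theorem stub_endChartDatum :
    ∀ (X : Type) [TopologicalSpace X] [ChartedSpace E3 X] [IsManifold (𝓡 3) ∞ X] [T2Space X]
      [SecondCountableTopology X] [ConnectedSpace X], ∀ d ∈ admissibleVacuumData X,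
      ∃ (e : AFEnd X) (M : ℝ) (I₀ : InitialDataSet (𝓡 3) E3),
        e.IsSoleEnd ∧ e.IsStronglyAsymptoticallyFlatDR d M ∧ VacuumOn {y | 2 * e.R < ‖y‖} I₀ ∧
        ∀ y : E3, 2 * e.R ≤ ‖y‖ → I₀.coordH y = AFEnd.hCoeff e d y ∧ I₀.coordK y = AFEnd.kCoeff e d y := by
  intro X _ _ _ _ _ _ d hd
  obtain ⟨hvc, e, M, hsole, hDR⟩ := hd
  have hdvac : ∀ [d.metric.HasLeviCivita], d.IsVacuumConstraintSolution := fun {inst} ↦ hvc.1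
  obtain ⟨I₀, hvac, hread⟩ := exists_endChartDatum e d hdvac
  exact ⟨e, M, I₀, hsole, hDR, hvac, hread⟩

end Summit.FinalStateConjecture.FinalStateConjecture.Theorems.SwallowTheDatum.ParametricKerrBurial

end
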